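import Literature.NumberTheory.LFunctions.Zhang2022.RepairCrossFormDictionary
import Literature.NumberTheory.LFunctions.Zhang2022.RepairTentForm

/-!
# K-S3 faithfulness, `H₁`-blocks: formula I on `(H₁, J₁)` IS the transcribed `d₃ⱼ`, `d₄ⱼ` of §10

Trunk T-ANT (NumberTheory/LFunctions). Repair rung F-S1R (D-0077) for Y. Zhang, *Discrete mean estimates and
the Landau–Siegel zero*, arXiv:2211.02515v1 [Zhang2022LandauSiegel] — **an unrefereed manuscript under
adjudication; nothing here asserts any of its claims.** Companion of `RepairCrossFormDictionary` (the cross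
functional of record `dSum1S θ = M(g₁,f) + conj M(f,g₁)` and its identification with the polar form) and of
`RepairSection10Theta` (the literal transcription `d3T θ j`, `d4T θ j` of the displays before (10.12)/(10.13)).

For the `H₁`-profile `g₁ = ϰ_{ν₁,k₁} + ι₂ϰ_{ν₂,k₂}` (`h1Profile`) and the tent `f` of `J₁ = [ν₂, ν₁]` (`tentT`), the
formula-I integral splits over the regions `[0,ν₂] ∪ [ν₂,mid₁] ∪ [mid₁,ν₁] ∪ [ν₁,1]` of §10 ("The right side is split
into three sums according to `dr < P^{0.5}`, `P^{0.5} ≤ dr < P^{0.502}`, `P^{0.502} ≤ dr < P^{0.504}`", p.55), and on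
each region the dipole identities (`RepairKappaProfile.kappaP'_add_eq_ffT`, `conj_kappa_gside_eq_ghT`;
`RepairTentProfile.tentDipole_*`, `tentTail_*`) turn the integrand into the printed one:

* `integral_dipoleIntegrand_h1_tent : ∫₀¹ (g₁′+iπjg₁)·conj(f′+iπS_jf+π²N_j∫_y^1f) = π·d3T θ j`
  (region `dr < P^{ν₂}`: the `−(N_jπ/σ)∫₀^{ν₂}` term after `z = ν₂ − y`; the two tent halves: the `±1` parts give
  `(σ/(ν₁π))∫₀^h(𝔣𝔣(z) − 𝔣𝔣(h+z))` after `w = ν₁ − y`, the `𝔶𝔶` parts are verbatim; `H₁₂`'s profile is invisible on the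
  tent because `ν₂ = lo₁`);
* `integral_dipoleIntegrand_tent_h1 : ∫₀¹ (f′+iπjf)·conj(g₁′+iπS_jg₁+π²N_j∫_y^1g₁) = π·d4T θ j`;
* hence **`dSum1S_eq_section10 : dSum1S θ = Σ_j W_j (d3T θ j + conj (d4T θ j))`** — the `𝔡`-block of the structural
  dictionary IS the manuscript's (10.12) + conj (10.13) at every admissible design (no face condition needed here:
  `J₁`'s blocks do not see `ν₂` vs `1/2`).

Pure calculus (interval splitting, the substitutions `y ↦ c − y`, linearity); no new `Prop` facts, no statement about
Theorems 1–2.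
-/

noncomputable section

open Complex Real ComplexConjugate MeasureTheory Set intervalIntegral
open scoped Interval

namespace Literature.NumberTheory.LFunctions.Zhang2022

namespace Repair

variable {θ : Theta}

/-- continuity of the `𝔣𝔣`-profiles (local copy for `fun_prop`). [cite: Zhang2022LandauSiegel, (8.13)–(8.18)] -/
@[fun_prop] private theorem ffT_cont (k : ℝ) (j : ℕ) : Continuous (ffT k j) := by unfold ffT ffR; fun_prop
/-- continuity of the `𝔤𝔥`-profiles. [cite: Zhang2022LandauSiegel, (8.13)–(8.18)] -/
@[fun_prop] private theorem ghT_cont (k : ℝ) (j : ℕ) : Continuous (ghT k j) := by unfold ghT ghR; fun_prop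

/-- bounds extracted from the class. [cite: Zhang2022LandauSiegel, §2 (2.21)–(2.28)] -/
private theorem AdmissibleTheta.h1_bounds (h : AdmissibleTheta θ) :
    0 < θ.nu2 ∧ θ.nu2 < θ.nu1 ∧ θ.nu1 < 1 ∧ θ.k1 ≠ 0 ∧ θ.k2 ≠ 0 := by
  obtain ⟨⟨h32, h21⟩, -, h1, h13, -, ⟨⟨hk1, -⟩, ⟨hk2, -⟩, -⟩, -⟩ := h
  unfold Theta.belowP at h1
  unfold Theta.dualRangesNonempty at h13
  exact ⟨by linarith, h21, h1, hk1.ne', hk2.ne'⟩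

/-! ### The `m`-side and the tail of `g₁ = ϰ₁ + ι₂ϰ₂` on the regions of §10 -/

/-- below `P^{ν₂}`: `g₁′ + iπjg₁ = −𝔣𝔣_{j,1}(ν₁−y)/ν₁ − ι₂𝔣𝔣_{j,2}(ν₂−y)/ν₂` (Lemma 8.2 for both components).
[cite: Zhang2022LandauSiegel, §10 before (10.12) p.55] -/
theorem h1_mside_of_lt (h1 : θ.nu1 ≠ 0) (h2 : θ.nu2 ≠ 0) (j : ℕ) {y : ℝ} (hy2 : y < θ.nu2) (hy1 : y < θ.nu1) :
    h1Profile' θ y + I * π * (j : ℂ) * h1Profile θ y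
      = -(((1 / θ.nu1 : ℝ)) : ℂ) * ffT θ.k1 j (θ.nu1 - y)
        - θ.iota2 * ((((1 / θ.nu2 : ℝ)) : ℂ) * ffT θ.k2 j (θ.nu2 - y)) := by
  have e1 := kappaP'_add_eq_ffT (k := θ.k1) h1 j hy1
  have e2 := kappaP'_add_eq_ffT (k := θ.k2) h2 j hy2
  unfold h1Profile h1Profile' pairProfile pairProfile'
  linear_combination e1 + θ.iota2 * e2

/-- on the tent (`ν₂ ≤ y < ν₁`): `g₁′ + iπjg₁ = −𝔣𝔣_{j,1}(ν₁−y)/ν₁` (`H₁₂`'s profile has ended at `ν₂ = lo₁`).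
[cite: Zhang2022LandauSiegel, §10 before (10.12) p.55] -/
theorem h1_mside_of_mid (h1 : θ.nu1 ≠ 0) (h2 : θ.nu2 ≠ 0) (j : ℕ) {y : ℝ} (hy2 : θ.nu2 ≤ y) (hy1 : y < θ.nu1) :
    h1Profile' θ y + I * π * (j : ℂ) * h1Profile θ y = -(((1 / θ.nu1 : ℝ)) : ℂ) * ffT θ.k1 j (θ.nu1 - y) := by
  have e1 := kappaP'_add_eq_ffT (k := θ.k1) h1 j hy1
  unfold h1Profile h1Profile' pairProfile pairProfile'
  rw [kappaP'_of_ge (k := θ.k2) hy2, kappaP_of_ge (k := θ.k2) h2 hy2]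
  linear_combination e1

/-- above `P^{ν₁}`: `g₁′ + iπjg₁ = 0`. [cite: Zhang2022LandauSiegel, §10 before (10.12) p.55] -/
theorem h1_mside_of_ge (h1 : θ.nu1 ≠ 0) (h2 : θ.nu2 ≠ 0) (h21 : θ.nu2 ≤ θ.nu1) (j : ℕ) {y : ℝ}
    (hy : θ.nu1 ≤ y) : h1Profile' θ y + I * π * (j : ℂ) * h1Profile θ y = 0 := by
  unfold h1Profile h1Profile' pairProfile pairProfile'
  rw [kappaP'_of_ge (k := θ.k1) hy, kappaP_of_ge (k := θ.k1) h1 hy, kappaP'_of_ge (k := θ.k2) (h21.trans hy),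
    kappaP_of_ge (k := θ.k2) h2 (h21.trans hy)]
  ring

/-- the tail functional of `g₁` on the tent (`ν₂ ≤ y < ν₁ ≤ 1`): `conj(g₁′+iπS_jg₁+π²N_j∫_y^1g₁) = −𝔤𝔥_{j,1}(ν₁−y)/ν₁`
(Lemma 8.4 for `H₁₁`; `H₁₂` has ended). [cite: Zhang2022LandauSiegel, §10 before (10.13) p.56] -/
theorem h1_tail_of_mid (h2 : 0 < θ.nu2) (h21 : θ.nu2 ≤ θ.nu1) (h1 : θ.nu1 ≤ 1) (hk1 : θ.k1 ≠ 0) (j : ℕ)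
    {y : ℝ} (hy2 : θ.nu2 ≤ y) (hy1 : y < θ.nu1) :
    conj (h1Profile' θ y + I * π * ((bS j : ℝ) : ℂ) * h1Profile θ y
        + (π : ℂ) ^ 2 * ((bN j : ℝ) : ℂ) * ∫ t in y..1, h1Profile θ t)
      = -(((1 / θ.nu1 : ℝ)) : ℂ) * ghT θ.k1 j (θ.nu1 - y) := by
  have hν1 : 0 < θ.nu1 := h2.trans_le h21
  have e1 := conj_kappa_gside_eq_ghT (k := θ.k1) hk1 hν1 h1 j hy1
  have i1 : IntervalIntegrable (kappaP θ.nu1 θ.k1) volume y 1 :=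
    ((kinkedProfile_kappaP (k := θ.k1) hν1 h1).cont.mono (Icc_subset_Icc (by linarith) le_rfl)).intervalIntegrable_of_Icc
      (by linarith)
  have i2 : IntervalIntegrable (kappaP θ.nu2 θ.k2) volume y 1 :=
    ((kinkedProfile_kappaP (k := θ.k2) h2 (h21.trans h1)).cont.mono (Icc_subset_Icc (by linarith) le_rfl)).intervalIntegrable_of_Icc
      (by linarith)
  have hint : (∫ t in y..1, h1Profile θ t) = (∫ t in y..1, kappaP θ.nu1 θ.k1 t)
      + θ.iota2 * ∫ t in y..1, kappaP θ.nu2 θ.k2 t := by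
    unfold h1Profile pairProfile
    rw [intervalIntegral.integral_add (by simpa using i1) (i2.const_mul _), intervalIntegral.integral_const_mul]
    simp
  rw [hint, integral_kappaP_tail_of_ge (k := θ.k2) h2 hy2 (by linarith)]
  unfold h1Profile h1Profile' pairProfile pairProfile'
  rw [kappaP'_of_ge (k := θ.k2) hy2, kappaP_of_ge (k := θ.k2) h2.ne' hy2]
  have : kappaP' θ.nu1 θ.k1 y + I * π * ((bS j : ℝ) : ℂ) * kappaP θ.nu1 θ.k1 y
      + (π : ℂ) ^ 2 * ((bN j : ℝ) : ℂ) * ∫ t in y..1, kappaP θ.nu1 θ.k1 t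
      = 1 * kappaP' θ.nu1 θ.k1 y + θ.iota2 * 0 + I * π * ((bS j : ℝ) : ℂ) * (1 * kappaP θ.nu1 θ.k1 y + θ.iota2 * 0)
        + (π : ℂ) ^ 2 * ((bN j : ℝ) : ℂ) * ((∫ t in y..1, kappaP θ.nu1 θ.k1 t) + θ.iota2 * 0) := by ring
  rw [← this, e1]

/-- above `P^{ν₁}` the tail of `g₁` vanishes. [cite: Zhang2022LandauSiegel, §10 before (10.13) p.56] -/
theorem h1_tail_of_ge (h2 : 0 < θ.nu2) (h21 : θ.nu2 ≤ θ.nu1) (h1 : θ.nu1 ≤ 1) (j : ℕ) {y : ℝ}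
    (hy : θ.nu1 ≤ y) (hy1 : y ≤ 1) :
    conj (h1Profile' θ y + I * π * ((bS j : ℝ) : ℂ) * h1Profile θ y
        + (π : ℂ) ^ 2 * ((bN j : ℝ) : ℂ) * ∫ t in y..1, h1Profile θ t) = 0 := by
  have hν1 : 0 < θ.nu1 := h2.trans_le h21
  have i1 : IntervalIntegrable (kappaP θ.nu1 θ.k1) volume y 1 :=
    ((kinkedProfile_kappaP (k := θ.k1) hν1 h1).cont.mono (Icc_subset_Icc (by linarith) le_rfl)).intervalIntegrable_of_Icc
      hy1
  have i2 : IntervalIntegrable (kappaP θ.nu2 θ.k2) volume y 1 :=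
    ((kinkedProfile_kappaP (k := θ.k2) h2 (h21.trans h1)).cont.mono (Icc_subset_Icc (by linarith) le_rfl)).intervalIntegrable_of_Icc
      hy1
  have hint : (∫ t in y..1, h1Profile θ t) = (∫ t in y..1, kappaP θ.nu1 θ.k1 t)
      + θ.iota2 * ∫ t in y..1, kappaP θ.nu2 θ.k2 t := by
    unfold h1Profile pairProfile
    rw [intervalIntegral.integral_add (by simpa using i1) (i2.const_mul _), intervalIntegral.integral_const_mul]
    simp
  rw [hint, integral_kappaP_tail_of_ge (k := θ.k1) hν1 hy hy1,
    integral_kappaP_tail_of_ge (k := θ.k2) h2 (h21.trans hy) hy1]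
  unfold h1Profile h1Profile' pairProfile pairProfile'
  rw [kappaP'_of_ge (k := θ.k1) hy, kappaP_of_ge (k := θ.k1) hν1.ne' hy, kappaP'_of_ge (k := θ.k2) (h21.trans hy),
    kappaP_of_ge (k := θ.k2) h2.ne' (h21.trans hy)]
  simp

/-! ### `∫₀¹ dipoleIntegrand j g₁ g₁′ f f′ = π·d₃ⱼ(θ)` -/

/-- **formula I on `(H₁, J̄₁)` is the manuscript's `d₃ⱼ`** (display before (10.12), generic design):
`∫₀¹ (g₁′+iπjg₁)·conj(f′+iπS_jf+π²N_j∫_y^1f) dy = π·d3T θ j`. [cite: Zhang2022LandauSiegel, §10 before (10.12) p.55–56] -/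
theorem integral_dipoleIntegrand_h1_tent (h : AdmissibleTheta θ) (j : ℕ) :
    ∫ y in (0:ℝ)..1, dipoleIntegrand j (h1Profile θ) (h1Profile' θ) (tentT θ) (tentT' θ) y = (π : ℂ) * d3T θ j := by
  obtain ⟨h2, h21, h1, hk1, hk2⟩ := h.h1_bounds
  have hν1 : 0 < θ.nu1 := h2.trans h21
  have hm := θ.mid1_eq; have hn := θ.nu1_eq; have hp := θ.hw_pos h21; have hs := θ.sig_mul_hw h21
  have hσ := θ.sig_pos h21
  have hI := intervalIntegrable_dipoleIntegrand (kinkedProfile_h1Profile h) (kinkedProfile_tentT h21) j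
  have hsub : ∀ {a b : ℝ}, 0 ≤ a → a ≤ b → b ≤ 1 →
      IntervalIntegrable (dipoleIntegrand j (h1Profile θ) (h1Profile' θ) (tentT θ) (tentT' θ)) volume a b :=
    fun ha hab hb => hI.mono_set (by rw [uIcc_of_le zero_le_one, uIcc_of_le hab]; exact Icc_subset_Icc ha hb)
  -- region `[0, ν₂]`: below the tent
  set F0 : ℝ → ℂ := fun z => ((1 / θ.nu1 : ℝ) : ℂ) * ffT θ.k1 j (θ.s12 + z) + θ.iota2 / (θ.nu2 : ℂ) * ffT θ.k2 j z
    with hF0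
  have e0 : ∫ y in (0:ℝ)..θ.nu2, dipoleIntegrand j (h1Profile θ) (h1Profile' θ) (tentT θ) (tentT' θ) y
      = -((π ^ 2 * bN j * θ.hw : ℝ) : ℂ) * ∫ z in (0:ℝ)..θ.nu2, F0 z := by
    have hc : ∫ y in (0:ℝ)..θ.nu2, F0 (θ.nu2 - y) = ∫ z in (0:ℝ)..θ.nu2, F0 z := by
      have := intervalIntegral.integral_comp_sub_left F0 θ.nu2 (a := 0) (b := θ.nu2)
      simpa only [sub_self, sub_zero] using this
    rw [← hc, ← intervalIntegral.integral_const_mul]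
    refine intervalIntegral.integral_congr_uIoo fun y hy => ?_
    rw [uIoo_of_le h2.le] at hy
    unfold dipoleIntegrand
    rw [h1_mside_of_lt hν1.ne' h2.ne' j hy.2 (hy.2.trans h21), tentTail_below h21 h1.le hy.2 j, hF0]
    simp only []
    rw [show θ.nu1 - y = θ.s12 + (θ.nu2 - y) by unfold Theta.s12; ring]
    have hν2c : (θ.nu2 : ℂ) ≠ 0 := by exact_mod_cast h2.ne'
    push_cast
    field_simp
    ring
  -- region `[ν₂, mid₁]`: lower half of the tent
  have e1 : ∫ y in θ.nu2..θ.mid1, dipoleIntegrand j (h1Profile θ) (h1Profile' θ) (tentT θ) (tentT' θ) y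
      = (((1 / θ.nu1 : ℝ)) : ℂ) * (θ.sig : ℂ) *
          (-(∫ y in θ.nu2..θ.mid1, ffT θ.k1 j (θ.hw + (θ.mid1 - y)))
            + ∫ y in θ.nu2..θ.mid1, ffT θ.k1 j (θ.nu1 - y) * yy1T θ j y) := by
    have iA : IntervalIntegrable (fun y => -ffT θ.k1 j (θ.hw + (θ.mid1 - y))) volume θ.nu2 θ.mid1 :=
      Continuous.intervalIntegrable (by fun_prop) _ _
    have iB : IntervalIntegrable (fun y => ffT θ.k1 j (θ.nu1 - y) * yy1T θ j y) volume θ.nu2 θ.mid1 :=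
      Continuous.intervalIntegrable (by unfold yy1T; fun_prop) _ _
    rw [← intervalIntegral.integral_neg, ← intervalIntegral.integral_add iA iB,
      ← intervalIntegral.integral_const_mul]
    refine intervalIntegral.integral_congr_uIoo fun y hy => ?_
    rw [uIoo_of_le (by linarith)] at hy
    unfold dipoleIntegrand
    rw [h1_mside_of_mid hν1.ne' h2.ne' j hy.1.le (by linarith [hy.2]), tentTail_lower h21 h1.le hy.1.le hy.2 j,
      show θ.hw + (θ.mid1 - y) = θ.nu1 - y by rw [hn]; ring]
    ring
  -- region `[mid₁, ν₁]`: upper half of the tent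
  have e2 : ∫ y in θ.mid1..θ.nu1, dipoleIntegrand j (h1Profile θ) (h1Profile' θ) (tentT θ) (tentT' θ) y
      = (((1 / θ.nu1 : ℝ)) : ℂ) * (θ.sig : ℂ) *
          ((∫ y in θ.mid1..θ.nu1, ffT θ.k1 j (θ.nu1 - y))
            + ∫ y in θ.mid1..θ.nu1, ffT θ.k1 j (θ.nu1 - y) * yy2T θ j y) := by
    have iA : IntervalIntegrable (fun y => ffT θ.k1 j (θ.nu1 - y)) volume θ.mid1 θ.nu1 :=
      Continuous.intervalIntegrable (by fun_prop) _ _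
    have iB : IntervalIntegrable (fun y => ffT θ.k1 j (θ.nu1 - y) * yy2T θ j y) volume θ.mid1 θ.nu1 :=
      Continuous.intervalIntegrable (by unfold yy2T; fun_prop) _ _
    rw [← intervalIntegral.integral_add iA iB, ← intervalIntegral.integral_const_mul]
    refine intervalIntegral.integral_congr_uIoo fun y hy => ?_
    rw [uIoo_of_le (by linarith)] at hy
    unfold dipoleIntegrand
    rw [h1_mside_of_mid hν1.ne' h2.ne' j (by linarith [hy.1]) hy.2, tentTail_upper h21 h1.le hy.1.le hy.2 j]
    ring
  -- region `[ν₁, 1]`: above the tent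
  have e3 : ∫ y in θ.nu1..1, dipoleIntegrand j (h1Profile θ) (h1Profile' θ) (tentT θ) (tentT' θ) y = 0 := by
    rw [intervalIntegral.integral_congr_uIoo (g := fun _ => (0:ℂ)) fun y hy => ?_, intervalIntegral.integral_zero]
    rw [uIoo_of_le h1.le] at hy
    unfold dipoleIntegrand
    rw [h1_mside_of_ge hν1.ne' h2.ne' h21.le j hy.1.le]; ring
  -- the two `±1` pieces are `∫₀^h 𝔣𝔣(h+z)` and `∫₀^h 𝔣𝔣(z)`
  have s1 : ∫ y in θ.nu2..θ.mid1, ffT θ.k1 j (θ.hw + (θ.mid1 - y)) = ∫ z in (0:ℝ)..θ.hw, ffT θ.k1 j (θ.hw + z) := by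
    have := intervalIntegral.integral_comp_sub_left (fun z => ffT θ.k1 j (θ.hw + z)) θ.mid1 (a := θ.nu2) (b := θ.mid1)
    rw [sub_self, show θ.mid1 - θ.nu2 = θ.hw by rw [hm]; ring] at this
    simpa only [] using this
  have s2 : ∫ y in θ.mid1..θ.nu1, ffT θ.k1 j (θ.nu1 - y) = ∫ z in (0:ℝ)..θ.hw, ffT θ.k1 j z := by
    have := intervalIntegral.integral_comp_sub_left (fun z => ffT θ.k1 j z) θ.nu1 (a := θ.mid1) (b := θ.nu1)
    rw [sub_self, show θ.nu1 - θ.mid1 = θ.hw by rw [hn]; ring] at this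
    simpa only [] using this
  have sd : (∫ z in (0:ℝ)..θ.hw, (ffT θ.k1 j z - ffT θ.k1 j (θ.hw + z)))
      = (∫ z in (0:ℝ)..θ.hw, ffT θ.k1 j z) - ∫ z in (0:ℝ)..θ.hw, ffT θ.k1 j (θ.hw + z) :=
    intervalIntegral.integral_sub (Continuous.intervalIntegrable (by fun_prop) _ _)
      (Continuous.intervalIntegrable (by fun_prop) _ _)
  -- assemble
  have t1 := intervalIntegral.integral_add_adjacent_intervals
    (hsub (a := 0) (b := θ.nu2) le_rfl h2.le (by linarith)) (hsub (a := θ.nu2) (b := 1) h2.le (by linarith) le_rfl)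
  have t2 := intervalIntegral.integral_add_adjacent_intervals
    (hsub (a := θ.nu2) (b := θ.mid1) h2.le (by linarith) (by linarith))
    (hsub (a := θ.mid1) (b := 1) (by linarith) (by linarith) le_rfl)
  have t3 := intervalIntegral.integral_add_adjacent_intervals
    (hsub (a := θ.mid1) (b := θ.nu1) (by linarith) (by linarith) h1.le)
    (hsub (a := θ.nu1) (b := 1) (by linarith) h1.le le_rfl)
  rw [← t1, ← t2, ← t3, e0, e1, e2, e3, s1, s2]
  unfold d3T
  rw [sd, ← hF0, θ.hw_eq_inv_sig h21]
  have hπ : (π : ℂ) ≠ 0 := by exact_mod_cast Real.pi_ne_zero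
  have hσc : (θ.sig : ℂ) ≠ 0 := by exact_mod_cast hσ.ne'
  have hν1c : (θ.nu1 : ℂ) ≠ 0 := by exact_mod_cast hν1.ne'
  push_cast
  field_simp
  ring

/-! ### `∫₀¹ dipoleIntegrand j f f′ g₁ g₁′ = π·d₄ⱼ(θ)` -/

/-- **formula I on `(J₁, H̄₁)` is the manuscript's `d₄ⱼ`** (display before (10.13), generic design):
`∫₀¹ (f′+iπjf)·conj(g₁′+iπS_jg₁+π²N_j∫_y^1g₁) dy = π·d4T θ j`. [cite: Zhang2022LandauSiegel, §10 before (10.13) p.56] -/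
theorem integral_dipoleIntegrand_tent_h1 (h : AdmissibleTheta θ) (j : ℕ) :
    ∫ y in (0:ℝ)..1, dipoleIntegrand j (tentT θ) (tentT' θ) (h1Profile θ) (h1Profile' θ) y = (π : ℂ) * d4T θ j := by
  obtain ⟨h2, h21, h1, hk1, hk2⟩ := h.h1_bounds
  have hν1 : 0 < θ.nu1 := h2.trans h21
  have hm := θ.mid1_eq; have hn := θ.nu1_eq; have hp := θ.hw_pos h21; have hσ := θ.sig_pos h21
  have hI := intervalIntegrable_dipoleIntegrand (kinkedProfile_tentT h21) (kinkedProfile_h1Profile h) j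
  have hsub : ∀ {a b : ℝ}, 0 ≤ a → a ≤ b → b ≤ 1 →
      IntervalIntegrable (dipoleIntegrand j (tentT θ) (tentT' θ) (h1Profile θ) (h1Profile' θ)) volume a b :=
    fun ha hab hb => hI.mono_set (by rw [uIcc_of_le zero_le_one, uIcc_of_le hab]; exact Icc_subset_Icc ha hb)
  -- below the tent: the `m`-side vanishes
  have e0 : ∫ y in (0:ℝ)..θ.nu2, dipoleIntegrand j (tentT θ) (tentT' θ) (h1Profile θ) (h1Profile' θ) y = 0 := by
    rw [intervalIntegral.integral_congr_uIoo (g := fun _ => (0:ℂ)) fun y hy => ?_, intervalIntegral.integral_zero]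
    rw [uIoo_of_le h2.le] at hy
    unfold dipoleIntegrand; rw [tentT'_of_lt_lo hy.2, tentT_of_le_lo h21 hy.2.le]; ring
  -- lower half: `σ(1+iπj(y−ν₂))·(−𝔤𝔥(ν₁−y)/ν₁)`, `y = mid₁ − z`, `ν₁ − y = h + z`, `y − ν₂ = h − z`
  set gL : ℝ → ℂ := fun z => ghT θ.k1 j (θ.hw + z) + I * π * (j : ℂ) * (ghT θ.k1 j (θ.hw + z) * (((θ.hw - z : ℝ)) : ℂ))
    with hgL
  have e1 : ∫ y in θ.nu2..θ.mid1, dipoleIntegrand j (tentT θ) (tentT' θ) (h1Profile θ) (h1Profile' θ) y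
      = -((((1 / θ.nu1 : ℝ)) : ℂ) * (θ.sig : ℂ)) * ∫ z in (0:ℝ)..θ.hw, gL z := by
    have hc : ∫ y in θ.nu2..θ.mid1, gL (θ.mid1 - y) = ∫ z in (0:ℝ)..θ.hw, gL z := by
      have := intervalIntegral.integral_comp_sub_left gL θ.mid1 (a := θ.nu2) (b := θ.mid1)
      rw [sub_self, show θ.mid1 - θ.nu2 = θ.hw by rw [hm]; ring] at this
      exact this
    rw [← hc, ← intervalIntegral.integral_const_mul]
    refine intervalIntegral.integral_congr_uIoo fun y hy => ?_
    rw [uIoo_of_le (by linarith)] at hy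
    unfold dipoleIntegrand
    rw [tentDipole_lower hy.1.le hy.2, h1_tail_of_mid h2 h21.le h1.le hk1 j hy.1.le (by linarith [hy.2]), hgL]
    simp only []
    rw [show θ.hw + (θ.mid1 - y) = θ.nu1 - y by rw [hn]; ring,
      show ((θ.hw - (θ.mid1 - y) : ℝ) : ℂ) = (y : ℂ) - θ.nu2 by rw [hm]; push_cast; ring]
    ring
  -- upper half: `−σ(1−iπj(ν₁−y))·(−𝔤𝔥(ν₁−y)/ν₁)`, `y = ν₁ − z`
  set gU : ℝ → ℂ := fun z => ghT θ.k1 j z - I * π * (j : ℂ) * (ghT θ.k1 j z * (z : ℂ)) with hgU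
  have e2 : ∫ y in θ.mid1..θ.nu1, dipoleIntegrand j (tentT θ) (tentT' θ) (h1Profile θ) (h1Profile' θ) y
      = ((((1 / θ.nu1 : ℝ)) : ℂ) * (θ.sig : ℂ)) * ∫ z in (0:ℝ)..θ.hw, gU z := by
    have hc : ∫ y in θ.mid1..θ.nu1, gU (θ.nu1 - y) = ∫ z in (0:ℝ)..θ.hw, gU z := by
      have := intervalIntegral.integral_comp_sub_left gU θ.nu1 (a := θ.mid1) (b := θ.nu1)
      rw [sub_self, show θ.nu1 - θ.mid1 = θ.hw by rw [hn]; ring] at this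
      exact this
    rw [← hc, ← intervalIntegral.integral_const_mul]
    refine intervalIntegral.integral_congr_uIoo fun y hy => ?_
    rw [uIoo_of_le (by linarith)] at hy
    unfold dipoleIntegrand
    rw [tentDipole_upper h21 hy.1.le hy.2, h1_tail_of_mid h2 h21.le h1.le hk1 j (by linarith [hy.1]) hy.2, hgU]
    simp only []
    push_cast
    ring
  -- above the tent
  have e3 : ∫ y in θ.nu1..1, dipoleIntegrand j (tentT θ) (tentT' θ) (h1Profile θ) (h1Profile' θ) y = 0 := by
    rw [intervalIntegral.integral_congr_uIoo (g := fun _ => (0:ℂ)) fun y hy => ?_, intervalIntegral.integral_zero]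
    rw [uIoo_of_le h1.le] at hy
    unfold dipoleIntegrand; rw [tentT'_of_hi_le h21 hy.1.le, tentT_of_hi_le h21 hy.1.le]; ring
  -- split `gL`, `gU` into the printed integrals
  have iGa : IntervalIntegrable (fun z => ghT θ.k1 j (θ.hw + z)) volume 0 θ.hw :=
    Continuous.intervalIntegrable (by fun_prop) _ _
  have iGb : IntervalIntegrable (fun z => ghT θ.k1 j (θ.hw + z) * (((θ.hw - z : ℝ)) : ℂ)) volume 0 θ.hw :=
    Continuous.intervalIntegrable (by fun_prop) _ _
  have iGc : IntervalIntegrable (fun z => ghT θ.k1 j z) volume 0 θ.hw := Continuous.intervalIntegrable (by fun_prop) _ _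
  have iGd : IntervalIntegrable (fun z => ghT θ.k1 j z * (z : ℂ)) volume 0 θ.hw :=
    Continuous.intervalIntegrable (by fun_prop) _ _
  have gl : (∫ z in (0:ℝ)..θ.hw, gL z) = (∫ z in (0:ℝ)..θ.hw, ghT θ.k1 j (θ.hw + z))
      + I * π * (j : ℂ) * ∫ z in (0:ℝ)..θ.hw, ghT θ.k1 j (θ.hw + z) * (((θ.hw - z : ℝ)) : ℂ) := by
    rw [hgL, intervalIntegral.integral_add iGa (iGb.const_mul _), intervalIntegral.integral_const_mul]
  have gu : (∫ z in (0:ℝ)..θ.hw, gU z) = (∫ z in (0:ℝ)..θ.hw, ghT θ.k1 j z)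
      - I * π * (j : ℂ) * ∫ z in (0:ℝ)..θ.hw, ghT θ.k1 j z * (z : ℂ) := by
    rw [hgU, intervalIntegral.integral_sub iGc (iGd.const_mul _), intervalIntegral.integral_const_mul]
  have d1 : (∫ z in (0:ℝ)..θ.hw, (ghT θ.k1 j z - ghT θ.k1 j (θ.hw + z)))
      = (∫ z in (0:ℝ)..θ.hw, ghT θ.k1 j z) - ∫ z in (0:ℝ)..θ.hw, ghT θ.k1 j (θ.hw + z) :=
    intervalIntegral.integral_sub iGc iGa
  have d2 : (∫ z in (0:ℝ)..θ.hw, (ghT θ.k1 j (θ.hw + z) * (((θ.hw - z : ℝ)) : ℂ) + ghT θ.k1 j z * (z : ℂ)))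
      = (∫ z in (0:ℝ)..θ.hw, ghT θ.k1 j (θ.hw + z) * (((θ.hw - z : ℝ)) : ℂ)) + ∫ z in (0:ℝ)..θ.hw, ghT θ.k1 j z * (z : ℂ) :=
    intervalIntegral.integral_add iGb iGd
  have t1 := intervalIntegral.integral_add_adjacent_intervals
    (hsub (a := 0) (b := θ.nu2) le_rfl h2.le (by linarith)) (hsub (a := θ.nu2) (b := 1) h2.le (by linarith) le_rfl)
  have t2 := intervalIntegral.integral_add_adjacent_intervals
    (hsub (a := θ.nu2) (b := θ.mid1) h2.le (by linarith) (by linarith))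
    (hsub (a := θ.mid1) (b := 1) (by linarith) (by linarith) le_rfl)
  have t3 := intervalIntegral.integral_add_adjacent_intervals
    (hsub (a := θ.mid1) (b := θ.nu1) (by linarith) (by linarith) h1.le)
    (hsub (a := θ.nu1) (b := 1) (by linarith) h1.le le_rfl)
  rw [← t1, ← t2, ← t3, e0, e1, e2, e3, gl, gu]
  unfold d4T
  rw [d1, d2]
  have hπ : (π : ℂ) ≠ 0 := by exact_mod_cast Real.pi_ne_zero
  have hν1c : (θ.nu1 : ℂ) ≠ 0 := by exact_mod_cast hν1.ne'
  push_cast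
  field_simp
  ring

/-! ### The `𝔡`-block of the dictionary is the transcribed (10.12) + conj (10.13) -/

/-- **K-S3 faithfulness, `H₁`-blocks**: `dSum1S θ = Σ_j W_j (d₃ⱼ(θ) + conj d₄ⱼ(θ))` for every admissible design —
the structural cross functional's `H₁`-part IS the manuscript's §10 evaluation, transcribed (`RepairSection10Theta`).
[cite: Zhang2022LandauSiegel, §10 (10.1), (10.12)–(10.13), (10.17)] -/
theorem dSum1S_eq_section10 (h : AdmissibleTheta θ) :
    dSum1S θ = 1 / 2 * (d3T θ 1 + conj (d4T θ 1)) + 2 * (d3T θ 2 + conj (d4T θ 2))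
      + 3 / 2 * (d3T θ 3 + conj (d4T θ 3)) := by
  unfold dSum1S Mform
  rw [integral_dipoleIntegrand_h1_tent h 1, integral_dipoleIntegrand_h1_tent h 2, integral_dipoleIntegrand_h1_tent h 3,
    integral_dipoleIntegrand_tent_h1 h 1, integral_dipoleIntegrand_tent_h1 h 2, integral_dipoleIntegrand_tent_h1 h 3]
  have hπ : (π : ℂ) ≠ 0 := by exact_mod_cast Real.pi_ne_zero
  simp only [map_add, map_mul, map_div₀, Complex.conj_ofReal, map_ofNat, map_one]
  push_cast
  field_simp
  ring

end Repair

end Literature.NumberTheory.LFunctions.Zhang2022
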